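import Summits.CriticalPhenomena.Ising3DConformalLimit.Theorems.InverseSquareTelemetryEtaBoundsFromTelemetry
import Literature.Geometry.Lorentzian.HarmonicAsymptotics
import HarnessLib

/-!
# Crux `PositiveSolutionAsymptotics` (stmt-CriticalPhenomena-4496), line `registered`:
# tools for the lead's assembly stub, file 1 — geometry of `ℤ³ ⊂ ℝ³`, chain bookkeeping,
# exterior suprema/infima, the comparison ball

THEOREM-ONLY helper file (`--supports stmt-CriticalPhenomena-4496`), imported by
`…PositiveSolutionAsymptoticsAssemblyStep.lean` and `…PositiveSolutionAsymptoticsAssembly.lean`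
(the assembly `stub_blowDownAssembly : T1 → T2 → T3 → T4 → S2` of the skeleton
`Cruxes/PositiveSolutionAsymptotics/Lines/birth.lean`). Everything is [folklore].
-/

noncomputable section

namespace Summit.CriticalPhenomena.Ising3DConformalLimit.Theorems.PositiveSolutionAsymptotics.Assembly

open Literature.Probability.LatticeModels Finset Set Filter Topology

/-! ### Euclidean geometry of `ℝ³` in coordinates -/

/-- Minkowski's inequality in `ℝ³`: `√(∑(aᵢ+bᵢ)²) ≤ √(∑aᵢ²) + √(∑bᵢ²)` (Cauchy–Schwarz). [folklore] -/
theorem sqrt_sumSq_add_le (a b : Fin 3 → ℝ) :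
    Real.sqrt (∑ i, (a i + b i) ^ 2) ≤ Real.sqrt (∑ i, a i ^ 2) + Real.sqrt (∑ i, b i ^ 2) := by
  have hA : 0 ≤ ∑ i, a i ^ 2 := Finset.sum_nonneg fun i _ => sq_nonneg _
  have hB : 0 ≤ ∑ i, b i ^ 2 := Finset.sum_nonneg fun i _ => sq_nonneg _
  have hCS : (∑ i, a i * b i) ^ 2 ≤ (∑ i, a i ^ 2) * (∑ i, b i ^ 2) :=
    Finset.sum_mul_sq_le_sq_mul_sq _ _ _
  have hab : ∑ i, a i * b i ≤ Real.sqrt (∑ i, a i ^ 2) * Real.sqrt (∑ i, b i ^ 2) := by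
    rw [← Real.sqrt_mul hA]
    calc ∑ i, a i * b i ≤ |∑ i, a i * b i| := le_abs_self _
      _ = Real.sqrt ((∑ i, a i * b i) ^ 2) := (Real.sqrt_sq_eq_abs _).symm
      _ ≤ Real.sqrt ((∑ i, a i ^ 2) * (∑ i, b i ^ 2)) := Real.sqrt_le_sqrt hCS
  have hexp : ∑ i, (a i + b i) ^ 2 = (∑ i, a i ^ 2) + (∑ i, b i ^ 2) + 2 * ∑ i, a i * b i := by
    simp only [Fin.sum_univ_three]; ring
  have hR : 0 ≤ Real.sqrt (∑ i, a i ^ 2) + Real.sqrt (∑ i, b i ^ 2) := by positivity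
  rw [← Real.sqrt_sq hR]
  refine Real.sqrt_le_sqrt ?_
  rw [hexp, add_sq, Real.sq_sqrt hA, Real.sq_sqrt hB]
  nlinarith [hab]

/-- Reverse triangle inequality `|z| ≤ |x| + |x - z|` in `ℝ³` (the form `|x| ≤ |z| + |x - z|` is the
tree's `Literature.Geometry.Lorentzian.sqrt_sum_sq_le_add`). [folklore] -/
theorem sqrt_sumSq_le_add_sub' (x z : Fin 3 → ℝ) :
    Real.sqrt (∑ i, z i ^ 2) ≤ Real.sqrt (∑ i, x i ^ 2) + Real.sqrt (∑ i, (x i - z i) ^ 2) := by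
  have h := sqrt_sumSq_add_le x (fun i => z i - x i)
  have e : (fun i => (x i + (z i - x i)) ^ 2) = fun i => z i ^ 2 := by
    funext i; ring
  have e' : (fun i => (z i - x i) ^ 2) = fun i => (x i - z i) ^ 2 := by
    funext i; ring
  simp only [e, e'] at h
  exact h

/-- `ℓ² ≤ ℓ¹` in `ℝ³`: `√(∑aᵢ²) ≤ ∑|aᵢ|`. [folklore] -/
theorem sqrt_sumSq_le_sum_abs (a : Fin 3 → ℝ) :
    Real.sqrt (∑ i, a i ^ 2) ≤ ∑ i, |a i| := by
  have h0 : 0 ≤ ∑ i, |a i| := Finset.sum_nonneg fun i _ => abs_nonneg _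
  rw [← Real.sqrt_sq h0]
  refine Real.sqrt_le_sqrt ?_
  have : ∑ i, a i ^ 2 = ∑ i, |a i| ^ 2 := Finset.sum_congr rfl fun i _ => (sq_abs _).symm
  rw [this, Fin.sum_univ_three, Fin.sum_univ_three]
  nlinarith [abs_nonneg (a 0), abs_nonneg (a 1), abs_nonneg (a 2)]

/-- Each coordinate is bounded by the Euclidean norm: `|aᵢ| ≤ √(∑aⱼ²)`. [folklore] -/
theorem abs_le_sqrt_sumSq (a : Fin 3 → ℝ) (i : Fin 3) : |a i| ≤ Real.sqrt (∑ j, a j ^ 2) := by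
  rw [← Real.sqrt_sq_eq_abs]
  exact Real.sqrt_le_sqrt (Finset.single_le_sum (fun j _ => sq_nonneg (a j)) (Finset.mem_univ i))

/-- `ℓ¹ ≤ 3 ℓ²` in `ℝ³`: `∑|aᵢ| ≤ 3 √(∑aᵢ²)`. [folklore] -/
theorem sum_abs_le_three_mul_sqrt (a : Fin 3 → ℝ) :
    ∑ i, |a i| ≤ 3 * Real.sqrt (∑ i, a i ^ 2) := by
  have h := fun i => abs_le_sqrt_sumSq a i
  rw [Fin.sum_univ_three]
  linarith [h 0, h 1, h 2]

/-- A unit lattice step changes the Euclidean distance to any point by at most `1`: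
`√(∑((x ± eₖ)ᵢ - zᵢ)²) ≤ √(∑(xᵢ - zᵢ)²) + 1`. [folklore] -/
theorem sqrt_sumSq_step_le (x z : Site 3) (k : Fin 3) :
    Real.sqrt (∑ i, ((((x + Pi.single k 1 : Site 3) i : ℤ) : ℝ) - ((z i : ℤ) : ℝ)) ^ 2) ≤
        Real.sqrt (∑ i, (((x i : ℤ) : ℝ) - ((z i : ℤ) : ℝ)) ^ 2) + 1 ∧
      Real.sqrt (∑ i, ((((x - Pi.single k 1 : Site 3) i : ℤ) : ℝ) - ((z i : ℤ) : ℝ)) ^ 2) ≤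
        Real.sqrt (∑ i, (((x i : ℤ) : ℝ) - ((z i : ℤ) : ℝ)) ^ 2) + 1 := by
  have hunit : ∀ σ : ℝ, σ ^ 2 = 1 →
      Real.sqrt (∑ i, ((Pi.single k σ : Fin 3 → ℝ) i) ^ 2) = 1 := by
    intro σ hσ
    have : ∑ i, ((Pi.single k σ : Fin 3 → ℝ) i) ^ 2 = 1 := by
      rw [Finset.sum_eq_single k]
      · simp [hσ]
      · intro j _ hj; simp [hj]
      · intro h; exact absurd (Finset.mem_univ k) h
    rw [this, Real.sqrt_one]
  constructor
  · have h := sqrt_sumSq_add_le (fun i => ((x i : ℤ) : ℝ) - ((z i : ℤ) : ℝ))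
      (fun i => (Pi.single k (1 : ℝ) : Fin 3 → ℝ) i)
    rw [hunit 1 (by norm_num)] at h
    refine le_trans (le_of_eq ?_) h
    congr 1
    refine Finset.sum_congr rfl fun i _ => ?_
    by_cases hi : i = k
    · subst hi; simp; ring
    · simp [hi]
  · have h := sqrt_sumSq_add_le (fun i => ((x i : ℤ) : ℝ) - ((z i : ℤ) : ℝ))
      (fun i => (Pi.single k (-1 : ℝ) : Fin 3 → ℝ) i)
    rw [hunit (-1) (by norm_num)] at h
    refine le_trans (le_of_eq ?_) h
    congr 1
    refine Finset.sum_congr rfl fun i _ => ?_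
    by_cases hi : i = k
    · subst hi; simp; ring
    · simp [hi]

/-! ### Elementary real bookkeeping -/

/-- Chain bookkeeping: if `a₀ ≥ Q - ζ₀` and each step loses at most `ζ ↦ C(3ηQ + ζ)`, then after `N`
steps `a_N ≥ Q - C^N (ζ₀ + 3NηQ)` (`C ≥ 1`, `η, Q, ζ₀ ≥ 0`). [folklore] -/
theorem chain_bound {a : ℕ → ℝ} {Q ζ₀ C η : ℝ} (hC : 1 ≤ C) (hη : 0 ≤ η) (hQ : 0 ≤ Q) (hζ₀ : 0 ≤ ζ₀)
    (N : ℕ) (h0 : Q - ζ₀ ≤ a 0)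
    (hstep : ∀ j : ℕ, j < N → ∀ ζ : ℝ, 0 ≤ ζ → Q - ζ ≤ a j → Q - C * (3 * η * Q + ζ) ≤ a (j + 1)) :
    Q - C ^ N * (ζ₀ + 3 * N * η * Q) ≤ a N := by
  have key : ∀ j : ℕ, j ≤ N → Q - C ^ j * (ζ₀ + 3 * j * η * Q) ≤ a j := by
    intro j
    induction j with
    | zero => intro _; simpa using h0
    | succ j ih =>
      intro hj
      have hjN : j < N := Nat.lt_of_succ_le hj
      have hCj : 1 ≤ C ^ j := one_le_pow₀ hC
      have hζ : 0 ≤ C ^ j * (ζ₀ + 3 * j * η * Q) := by positivity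
      have h := hstep j hjN _ hζ (ih hjN.le)
      refine le_trans ?_ h
      have hC0 : 0 ≤ C := by linarith
      have e : C ^ (j + 1) = C ^ j * C := pow_succ C j
      push_cast
      rw [e]
      have h1 : C * (3 * η * Q) ≤ C ^ j * C * (3 * η * Q) := by
        have h3 : 0 ≤ C * (3 * η * Q) := by positivity
        have := mul_le_mul_of_nonneg_right hCj h3
        linarith [this]
      nlinarith [h1]
  exact key N le_rfl

/-- `1/(1-η) - 1/(1+η) ≤ 3η` for `0 ≤ η ≤ 1/2`. [folklore] -/
theorem inv_sub_inv_le_three_mul {η : ℝ} (h0 : 0 ≤ η) (h1 : η ≤ 1 / 2) :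
    1 / (1 - η) - 1 / (1 + η) ≤ 3 * η := by
  have ha : 0 < 1 - η := by linarith
  have hb : 0 < 1 + η := by linarith
  rw [div_sub_div _ _ ha.ne' hb.ne', div_le_iff₀ (mul_pos ha hb)]
  have hsq : η ^ 2 ≤ 1 / 4 := by nlinarith
  have key : 0 ≤ η * (1 - 3 * η ^ 2) := mul_nonneg h0 (by linarith)
  nlinarith [key]

/-! ### Suprema and infima of a bounded function over exterior regions -/

/-- Every exterior region `{S ≤ ∑ xᵢ²}` of `ℤ³` contains a lattice point. [folklore] -/
theorem exists_sumSq_ge (S : ℝ) : ∃ x : Site 3, S ≤ ∑ i, ((x i : ℤ) : ℝ) ^ 2 := by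
  obtain ⟨n, hn⟩ := exists_nat_ge (max S 1)
  refine ⟨Pi.single 0 (n : ℤ), ?_⟩
  have hs : ∑ i, (((Pi.single 0 (n : ℤ) : Site 3) i : ℤ) : ℝ) ^ 2 = (n : ℝ) ^ 2 := by
    simp [Fin.sum_univ_three]
  rw [hs]
  have h1 : (1 : ℝ) ≤ n := le_trans (le_max_right _ _) hn
  have hS : S ≤ n := le_trans (le_max_left _ _) hn
  nlinarith

/-- `q ≤ sup` on the exterior region (`q` bounded above). [folklore] -/
theorem le_csSup_exterior {q : Site 3 → ℝ} {B : ℝ} (hB : ∀ x, q x ≤ B) {S : ℝ} {x : Site 3}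
    (hx : S ≤ ∑ i, ((x i : ℤ) : ℝ) ^ 2) :
    q x ≤ sSup (q '' {y : Site 3 | S ≤ ∑ i, ((y i : ℤ) : ℝ) ^ 2}) :=
  le_csSup ⟨B, by rintro _ ⟨y, -, rfl⟩; exact hB y⟩ ⟨x, hx, rfl⟩

/-- The exterior supremum is below any bound valid on the region. [folklore] -/
theorem csSup_exterior_le {q : Site 3 → ℝ} {S K : ℝ}
    (hK : ∀ x : Site 3, S ≤ ∑ i, ((x i : ℤ) : ℝ) ^ 2 → q x ≤ K) :
    sSup (q '' {y : Site 3 | S ≤ ∑ i, ((y i : ℤ) : ℝ) ^ 2}) ≤ K := by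
  obtain ⟨x₀, hx₀⟩ := exists_sumSq_ge S
  refine csSup_le ⟨q x₀, x₀, hx₀, rfl⟩ ?_
  rintro _ ⟨y, hy, rfl⟩
  exact hK y hy

/-- `inf ≤ q` on the exterior region (`q` bounded below). [folklore] -/
theorem csInf_exterior_le {q : Site 3 → ℝ} {b : ℝ} (hb : ∀ x, b ≤ q x) {S : ℝ} {x : Site 3}
    (hx : S ≤ ∑ i, ((x i : ℤ) : ℝ) ^ 2) :
    sInf (q '' {y : Site 3 | S ≤ ∑ i, ((y i : ℤ) : ℝ) ^ 2}) ≤ q x :=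
  csInf_le ⟨b, by rintro _ ⟨y, -, rfl⟩; exact hb y⟩ ⟨x, hx, rfl⟩

/-- The exterior infimum is above any lower bound valid on the region. [folklore] -/
theorem le_csInf_exterior {q : Site 3 → ℝ} {S K : ℝ}
    (hK : ∀ x : Site 3, S ≤ ∑ i, ((x i : ℤ) : ℝ) ^ 2 → K ≤ q x) :
    K ≤ sInf (q '' {y : Site 3 | S ≤ ∑ i, ((y i : ℤ) : ℝ) ^ 2}) := by
  obtain ⟨x₀, hx₀⟩ := exists_sumSq_ge S
  refine le_csInf ⟨q x₀, x₀, hx₀, rfl⟩ ?_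
  rintro _ ⟨y, hy, rfl⟩
  exact hK y hy

/-- The exterior supremum is antitone in the level. [folklore] -/
theorem antitone_csSup_exterior {q : Site 3 → ℝ} {B : ℝ} (hB : ∀ x, q x ≤ B) :
    Antitone fun S : ℝ => sSup (q '' {y : Site 3 | S ≤ ∑ i, ((y i : ℤ) : ℝ) ^ 2}) := by
  intro S S' hSS'
  obtain ⟨x₀, hx₀⟩ := exists_sumSq_ge S'
  exact csSup_le_csSup ⟨B, by rintro _ ⟨y, -, rfl⟩; exact hB y⟩ ⟨q x₀, x₀, hx₀, rfl⟩
    (Set.image_mono fun y (hy : S' ≤ _) => le_trans hSS' hy)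

/-- The exterior infimum is monotone in the level. [folklore] -/
theorem monotone_csInf_exterior {q : Site 3 → ℝ} {b : ℝ} (hb : ∀ x, b ≤ q x) :
    Monotone fun S : ℝ => sInf (q '' {y : Site 3 | S ≤ ∑ i, ((y i : ℤ) : ℝ) ^ 2}) := by
  intro S S' hSS'
  obtain ⟨x₀, hx₀⟩ := exists_sumSq_ge S'
  exact csInf_le_csInf ⟨b, by rintro _ ⟨y, -, rfl⟩; exact hb y⟩ ⟨q x₀, x₀, hx₀, rfl⟩
    (Set.image_mono fun y (hy : S' ≤ _) => le_trans hSS' hy)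

/-- The exterior suprema of a bounded function converge (to their infimum) as the level tends to
infinity. [folklore] -/
theorem tendsto_csSup_exterior {q : Site 3 → ℝ} {b B : ℝ} (hb : ∀ x, b ≤ q x) (hB : ∀ x, q x ≤ B) :
    Tendsto (fun S : ℝ => sSup (q '' {y : Site 3 | S ≤ ∑ i, ((y i : ℤ) : ℝ) ^ 2})) atTop
      (𝓝 (⨅ S : ℝ, sSup (q '' {y : Site 3 | S ≤ ∑ i, ((y i : ℤ) : ℝ) ^ 2}))) := by
  refine tendsto_atTop_ciInf (antitone_csSup_exterior hB) ⟨b, ?_⟩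
  rintro _ ⟨S, rfl⟩
  obtain ⟨x₀, hx₀⟩ := exists_sumSq_ge S
  exact (hb x₀).trans (le_csSup_exterior hB hx₀)

/-- The exterior infima of a bounded function converge (to their supremum) as the level tends to
infinity. [folklore] -/
theorem tendsto_csInf_exterior {q : Site 3 → ℝ} {b B : ℝ} (hb : ∀ x, b ≤ q x) (hB : ∀ x, q x ≤ B) :
    Tendsto (fun S : ℝ => sInf (q '' {y : Site 3 | S ≤ ∑ i, ((y i : ℤ) : ℝ) ^ 2})) atTop
      (𝓝 (⨆ S : ℝ, sInf (q '' {y : Site 3 | S ≤ ∑ i, ((y i : ℤ) : ℝ) ^ 2}))) := by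
  refine tendsto_atTop_ciSup (monotone_csInf_exterior hb) ⟨B, ?_⟩
  rintro _ ⟨S, rfl⟩
  obtain ⟨x₀, hx₀⟩ := exists_sumSq_ge S
  exact (csInf_exterior_le hb hx₀).trans (hB x₀)

/-! ### The lattice ball about a chain point -/

/-- **Geometry of the comparison ball.** For a chain point `z_c` with `r/4 ≤ |z_c| ≤ 2r` (`r ≥ 64`)
the lattice ball `D = {∑(xᵢ - z_{c,i})² ≤ (r/8)²}` is finite, `D ∪ ∂D ⊆ {r/10 ≤ |x| ≤ 3r}`, `D`
contains the `ℓ¹`-ball of radius `2⌈3r/64⌉` about `z_c`, and every lattice point at Euclidean distance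
`≤ r/64` from `z_c` lies in the `ℓ¹`-ball of radius `⌈3r/64⌉`. [folklore] -/
theorem ball_geometry :
    ∀ (r : ℝ), 64 ≤ r → ∀ (zc : Literature.Probability.LatticeModels.Site 3),
    r / 4 ≤ Real.sqrt (∑ i, ((zc i : ℤ) : ℝ) ^ 2) → Real.sqrt (∑ i, ((zc i : ℤ) : ℝ) ^ 2) ≤ 2 * r →
    ({x : Literature.Probability.LatticeModels.Site 3 | ∑ i, (((x i : ℤ) : ℝ) - ((zc i : ℤ) : ℝ)) ^ 2 ≤ (r / 8) ^ 2}).Finite ∧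
    (∀ x ∈ {x : Literature.Probability.LatticeModels.Site 3 | ∑ i, (((x i : ℤ) : ℝ) - ((zc i : ℤ) : ℝ)) ^ 2 ≤ (r / 8) ^ 2} ∪
        Literature.Probability.LatticeModels.zdOuterBoundary {x : Literature.Probability.LatticeModels.Site 3 | ∑ i, (((x i : ℤ) : ℝ) - ((zc i : ℤ) : ℝ)) ^ 2 ≤ (r / 8) ^ 2},
      r / 10 ≤ Real.sqrt (∑ i, ((x i : ℤ) : ℝ) ^ 2) ∧ Real.sqrt (∑ i, ((x i : ℤ) : ℝ) ^ 2) ≤ 3 * r) ∧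
    (∀ x : Literature.Probability.LatticeModels.Site 3, (∑ i, |x i - zc i|) ≤ 2 * ((⌈3 * (r / 64)⌉₊ : ℕ) : ℤ) →
      x ∈ {x : Literature.Probability.LatticeModels.Site 3 | ∑ i, (((x i : ℤ) : ℝ) - ((zc i : ℤ) : ℝ)) ^ 2 ≤ (r / 8) ^ 2}) ∧
    (∀ z' : Literature.Probability.LatticeModels.Site 3, Real.sqrt (∑ i, (((z' i : ℤ) : ℝ) - ((zc i : ℤ) : ℝ)) ^ 2) ≤ (1 / 64) * r →
      (∑ i, |z' i - zc i|) ≤ ((⌈3 * (r / 64)⌉₊ : ℕ) : ℤ)) := by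
  intro r hr zc hzlo hzhi
  set D : Set (Site 3) := {x : Site 3 | ∑ i, (((x i : ℤ) : ℝ) - ((zc i : ℤ) : ℝ)) ^ 2 ≤ (r / 8) ^ 2}
    with hD
  have hr0 : 0 < r := by linarith
  -- distance to `zc` on `D` and on `∂D`
  have hdistD : ∀ x ∈ D, Real.sqrt (∑ i, (((x i : ℤ) : ℝ) - ((zc i : ℤ) : ℝ)) ^ 2) ≤ r / 8 := by
    intro x hx
    rw [← Real.sqrt_sq (by positivity : (0 : ℝ) ≤ r / 8)]
    exact Real.sqrt_le_sqrt hx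
  have hdistU : ∀ x ∈ D ∪ zdOuterBoundary D,
      Real.sqrt (∑ i, (((x i : ℤ) : ℝ) - ((zc i : ℤ) : ℝ)) ^ 2) ≤ r / 8 + 1 := by
    intro x hx
    rcases hx with hx | ⟨-, y, hy, k, hxy⟩
    · linarith [hdistD x hx]
    · have hy' := hdistD y hy
      rcases hxy with rfl | rfl
      · linarith [(sqrt_sumSq_step_le y zc k).1]
      · linarith [(sqrt_sumSq_step_le y zc k).2]
  -- norms on `D ∪ ∂D`
  have hnormU : ∀ x ∈ D ∪ zdOuterBoundary D,
      r / 10 ≤ Real.sqrt (∑ i, ((x i : ℤ) : ℝ) ^ 2) ∧ Real.sqrt (∑ i, ((x i : ℤ) : ℝ) ^ 2) ≤ 3 * r := by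
    intro x hx
    have hd := hdistU x hx
    have h1 := Literature.Geometry.Lorentzian.sqrt_sum_sq_le_add (fun i => ((x i : ℤ) : ℝ))
      (fun i => ((zc i : ℤ) : ℝ))
    have h2 := sqrt_sumSq_le_add_sub' (fun i => ((x i : ℤ) : ℝ)) (fun i => ((zc i : ℤ) : ℝ))
    constructor <;> nlinarith [h1, h2, hd, hzlo, hzhi, hr]
  refine ⟨?_, hnormU, ?_, ?_⟩
  · -- finiteness
    refine (EtaBoundsFromTelemetry.finite_sumSq_le ((3 * r) ^ 2)).subset fun x hx => ?_
    have h := (hnormU x (Or.inl hx)).2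
    have h0 : (0 : ℝ) ≤ ∑ i, ((x i : ℤ) : ℝ) ^ 2 := by positivity
    have := Real.sq_sqrt h0
    show ∑ i, ((x i : ℤ) : ℝ) ^ 2 ≤ (3 * r) ^ 2
    nlinarith [Real.sqrt_nonneg (∑ i, ((x i : ℤ) : ℝ) ^ 2)]
  · -- the `ℓ¹`-ball of radius `2⌈3r/64⌉` lies in `D`
    intro x hx
    have hceil : ((⌈3 * (r / 64)⌉₊ : ℕ) : ℝ) < 3 * (r / 64) + 1 := Nat.ceil_lt_add_one (by positivity)
    have hx' : ((∑ i, |x i - zc i| : ℤ) : ℝ) ≤ 2 * ((⌈3 * (r / 64)⌉₊ : ℕ) : ℝ) := by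
      exact_mod_cast hx
    have hl2 := sqrt_sumSq_le_sum_abs (fun i => ((x i : ℤ) : ℝ) - ((zc i : ℤ) : ℝ))
    have hcast : (∑ i, |((x i : ℤ) : ℝ) - ((zc i : ℤ) : ℝ)|) = ((∑ i, |x i - zc i| : ℤ) : ℝ) := by
      push_cast; rfl
    rw [hcast] at hl2
    have hle : Real.sqrt (∑ i, (((x i : ℤ) : ℝ) - ((zc i : ℤ) : ℝ)) ^ 2) ≤ r / 8 := by linarith
    show ∑ i, (((x i : ℤ) : ℝ) - ((zc i : ℤ) : ℝ)) ^ 2 ≤ (r / 8) ^ 2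
    have h0 : (0 : ℝ) ≤ ∑ i, (((x i : ℤ) : ℝ) - ((zc i : ℤ) : ℝ)) ^ 2 := by positivity
    rw [← Real.sq_sqrt h0]
    exact pow_le_pow_left₀ (Real.sqrt_nonneg _) hle 2
  · -- a Euclidean step `≤ r/64` is an `ℓ¹` step `≤ ⌈3r/64⌉`
    intro z' hz'
    have hl1 := sum_abs_le_three_mul_sqrt (fun i => ((z' i : ℤ) : ℝ) - ((zc i : ℤ) : ℝ))
    have hcast : (∑ i, |((z' i : ℤ) : ℝ) - ((zc i : ℤ) : ℝ)|) = ((∑ i, |z' i - zc i| : ℤ) : ℝ) := by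
      push_cast; rfl
    rw [hcast] at hl1
    have hle : ((∑ i, |z' i - zc i| : ℤ) : ℝ) ≤ ((⌈3 * (r / 64)⌉₊ : ℕ) : ℝ) :=
      le_trans (by linarith) (Nat.le_ceil _)
    have hle' : ((∑ i, |z' i - zc i| : ℤ) : ℝ) ≤ (((⌈3 * (r / 64)⌉₊ : ℕ) : ℤ) : ℝ) := by
      exact_mod_cast hle
    exact_mod_cast hle'

end Summit.CriticalPhenomena.Ising3DConformalLimit.Theorems.PositiveSolutionAsymptotics.Assembly
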